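import Summits.CriticalPhenomena.PercolationContinuityZ3.Theorems.PercNearOneGluingNoHeavyLowerTailSahiGridPattern

/-!
# `NoHeavyLowerTail` (crux stmt-CriticalPhenomena-4575), Sahi programme P1: the pattern inequality holds in dimensions `d ≤ 3`
# [COMPUTATIONAL re-export of the `[3]³` certificate]

Support file (Sahi cell, seat `prim-sahi-p1`, generation 7; `--supports stmt-CriticalPhenomena-4575`).  No definitions, no `sorry`.
COMPUTATIONAL: both theorems depend on the `native_decide` certificate `SahiGrid3.sStar_nonneg_of_isUpperSet`
(`…SahiGridThreeCheck{,B,Two}`, eleven declared `native_decide` facts), read through `SahiGrid3.Ssym_nonneg` at the identity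
configuration of the three copies; `patternPos_of_le_three` then descends by `SahiGridPattern.patternPos_of_le` (pull-back along
the last axes, kernel).  With `SahiGridPattern.liebSahi_grid_of_patternPos` this recovers the cell `(3,3)` of `…SahiGridThree`.
(A kernel-only proof of `PatternPos 3` by bilinear slice certificates is in preparation in the same seat.) [this work]
-/

namespace Summit.CriticalPhenomena.PercolationContinuityZ3.Theorems.SahiGridPattern

/-- **`PatternPos 3`**: the `[3]³` pattern inequality (`sStarD A B C ≥ 0` for all `157 345 860` up-set triples) [COMPUTATIONAL:
the certificate of `…SahiGridThreeCheck*`, via `SahiGrid3.Ssym_nonneg` at the identity configuration `ω_c(a) = c`]. [this work] -/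
theorem patternPos_three : PatternPos 3 := by
  intro A B C hA hB hC
  have h := SahiGrid3.Ssym_nonneg (K := 2) hA hB hC (fun c _ => c)
  exact h

/-- `PatternPos d` for every `d ≤ 3` [COMPUTATIONAL for the same reason]. [this work] -/
theorem patternPos_of_le_three {d : ℕ} (hd : d ≤ 3) : PatternPos d :=
  patternPos_of_le hd patternPos_three

end Summit.CriticalPhenomena.PercolationContinuityZ3.Theorems.SahiGridPattern
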